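import Summits.HubbardSuperconductivity.HubbardSuperconductivity.Theses.ThermalWedge

/-!
# Route `ThermalWedge` — the crux as filed implies its restatement
# (`TwSeededEnsembleEquivalence`, stmt-HubbardSuperconductivity-1698 ⟹
#  `TwSeededEnsembleEquivalenceR`, stmt-HubbardSuperconductivity-15581)

Bookkeeping between the two route decls, kernel-checked over the route file itself:
`twSeededEnsembleEquivalenceR_of_twSeededEnsembleEquivalence` — the crux AS FILED
(`∀ g ∈ (0, 1/10]`, `∀ β ≥ 1`) implies the repaired thermal-window crux
(`g ∈ [K'U, 1/10]`, `1 ≤ β ≤ e^{a/U}`) with `a = K' = 1`: restriction of quantifiers.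
(Contrapositive, by `mt`: any refutation of the repaired crux refutes the crux as filed.)

Reading for planners: the deciding theorem `closes` of the route consumes
`TwSeededEnsembleEquivalenceR` only; by this theorem nothing the route needs is lost by dropping
the item as filed, which is kernel-equivalent to a T = 0 statement
(`Theorems/TwSeededEnsembleEquivalence/Negative/HullTouchNormalForm.lean`,
`twSeededEnsembleEquivalence_iff_hullTouchT0Strong`). The converse implication is NOT claimed
(and is not expected to be provable: a T = 0 density jump refutes the filed crux, not the repaired one).
-/

set_option linter.dupNamespace false

namespace Summit.HubbardSuperconductivity.HubbardSuperconductivity.Theorems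

open Summit.HubbardSuperconductivity.HubbardSuperconductivity.Theses.ThermalWedge

/-- **As filed ⟹ repaired.** `TwSeededEnsembleEquivalence` (stmt-HubbardSuperconductivity-1698:
every seed `g ∈ (0, 1/10]`, every `β ≥ 1`) implies `TwSeededEnsembleEquivalenceR`
(stmt-HubbardSuperconductivity-15581: seeds `g ∈ [K'U, 1/10]`, `1 ≤ β ≤ e^{a/U}`), with the same
window `[μ₁, μ₂]`, the same `U₀`, and `a := 1`, `K' := 1` (for `0 < U` the floor `1·U ≤ g` gives
`0 < g`; the temperature cap is simply not used). -/
theorem twSeededEnsembleEquivalenceR_of_twSeededEnsembleEquivalence :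
    TwSeededEnsembleEquivalence → TwSeededEnsembleEquivalenceR := by
  unfold TwSeededEnsembleEquivalenceR
  intro h δ hδ
  obtain ⟨μ₁, μ₂, hμ₁, hμ₁₂, hμ₂, U₀, hU₀, hU⟩ := h δ hδ
  refine ⟨μ₁, μ₂, hμ₁, hμ₁₂, hμ₂, 1, 1, U₀, one_pos, one_pos, hU₀, ?_⟩
  intro U hUm g hg β hβ1 _hβcap
  have hg' : g ∈ Set.Ioc (0 : ℝ) (1 / 10) := by
    refine ⟨lt_of_lt_of_le hUm.1 ?_, hg.2⟩
    simpa only [one_mul] using hg.1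
  exact hU U hUm g hg' β hβ1

end Summit.HubbardSuperconductivity.HubbardSuperconductivity.Theorems
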